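import Summits.ResolutionOfSingularities.KangarooAtlas.MizutaniOperatorOrder
import HarnessLib

/-!
# Mizutani's normal form `D = a D_1D_2 + b D_1^2 + c D_2^2` for a second-order operator killing the `p`-basis

Cell topic `Summits/ResolutionOfSingularities/KangarooAtlas` (pub-rosobs); namespace
`Summit.ResolutionOfSingularities.KangarooAtlas.Mizutani`.  Third piece of infrastructure for Mizutani's Lemma 2.9
(Nagoya Math. J. 52 (1973) p. 93: «Let `D_1, D_2` be elements of `Der(K/k^p)` defined by `D_i(t_j) = δ_{ij}`.  Then
`D = a D_1 D_2 + b D_1^2 + c D_2^2`» for `D ∈ Diff_2` with `D(1) = 0` and `t_1, t_2 ∈ ker D`).  For a root tower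
`h : IsRootTower L K q x a` with the `K`-basis `h.hsDBasis` of `End_L(K)` (`MizutaniOperatorBasis.lean`) and the order
filtration (`MizutaniOperatorOrder.lean`, `eq_sum_hsD_of_isDiffOpLE`):

* `IsRootTower.hsD_one`, **`IsRootTower.hsDBasis_repr_of_eq_zero`** — the coordinate of `D` at `W = 0` is `D 1`;
* `prod_pow_single_eq`, **`IsRootTower.hsDBasis_repr_of_eq_single`** — the coordinate at `W = e_i` is `D a_i − (D 1) a_i`;
* **`IsRootTower.eq_sum_degree_two_of_isDiffOpLE_two`** — an operator of order `≤ 2` with `D 1 = 0` and `D a_i = 0` for all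
  `i` is a `K`-combination of the `D^{(W)}` with `|W| = 2` (for two generators and `p ≠ 2`: `W ∈ {(2,0),(1,1),(0,2)}`).

References: [Mizutani1973HironakaGroupSchemes] Lemma 2.9 (proof, p. 93); [EGAIV4] Thm. 16.11.2.
-/

noncomputable section

open MvPolynomial Literature.AlgebraicGeometry.Resolution

namespace Summit.ResolutionOfSingularities.KangarooAtlas.Mizutani

universe u

section NormalForm

variable {L K : Type u} [Field L] [Field K] [Algebra L K] {s p e : ℕ} [hp : Fact p.Prime] [CharP K p]
  {x : Fin s → L} {a : Fin s → K}

/-! ### The coordinates at `W = 0` and `W = e_i` -/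

/-- `D^{(W)} 1 = 0` for `W ≠ 0` (and `= 1` for `W = 0`). [folklore] -/
theorem IsRootTower.hsD_one (h : IsRootTower L K (p ^ e) x a) (W : Fin s →₀ ℕ) (hW : W ≠ 0) : h.hsD W 1 = 0 := by
  have h1 : (1 : K) = ∏ i, a i ^ (0 : Fin s →₀ ℕ) i := by simp
  have hle : ¬ W ≤ 0 := fun hle => hW (le_antisymm hle bot_le)
  rw [h1, h.hsD_prod_pow' W 0 (fun i => by simpa using pow_pos hp.out.pos e), mchoose_eq_zero_of_not_le hle,
    Nat.cast_zero, zero_mul]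

/-- **The coordinate at `W = 0` is `D 1`.** [cite: Mizutani1973HironakaGroupSchemes, Lemma 2.9 (proof: D(1) = 0 removes the constant term)] -/
theorem IsRootTower.hsDBasis_repr_of_eq_zero (h : IsRootTower L K (p ^ e) x a) (D : K →ₗ[L] K)
    {W₀ : Fin s → Fin (p ^ e)} (hW₀ : finsuppOf W₀ = 0) : h.hsDBasis.repr D W₀ = D 1 := by
  classical
  have heval := congrArg (fun Φ : K →ₗ[L] K => Φ 1) (h.eq_sum_repr_hsD D)
  simp only [LinearMap.coe_sum, Finset.sum_apply, LinearMap.smul_apply, smul_eq_mul] at heval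
  rw [Finset.sum_eq_single W₀] at heval
  · rw [heval, hW₀, h.hsD_zero_apply, mul_one]
  · intro W _ hW
    have hW' : finsuppOf W ≠ 0 := by
      intro h0
      apply hW
      funext i
      apply Fin.ext
      have h1 := congrArg (fun M : Fin s →₀ ℕ => M i) h0
      have h2 := congrArg (fun M : Fin s →₀ ℕ => M i) hW₀
      simp only [finsuppOf_apply, Finsupp.coe_zero, Pi.zero_apply] at h1 h2
      omega
    rw [h.hsD_one _ hW', mul_zero]
  · intro hW₀'
    exact absurd (Finset.mem_univ W₀) hW₀'

omit [CharP K p] in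
/-- `a_i = a^{e_i}`. [folklore] -/
theorem prod_pow_single_eq (i : Fin s) : (∏ j, a j ^ (Finsupp.single i 1 : Fin s →₀ ℕ) j) = a i := by
  classical
  rw [Finset.prod_eq_single i]
  · rw [Finsupp.single_eq_same, pow_one]
  · intro j _ hj
    rw [Finsupp.single_eq_of_ne hj, pow_zero]
  · intro hi
    exact absurd (Finset.mem_univ i) hi

/-- **The coordinate at `W = e_i` is `D a_i − (D 1) a_i`.** [cite: Mizutani1973HironakaGroupSchemes, Lemma 2.9 (proof)] -/
theorem IsRootTower.hsDBasis_repr_of_eq_single (h : IsRootTower L K (p ^ e) x a) (D : K →ₗ[L] K)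
    {W₀ W₁ : Fin s → Fin (p ^ e)} (hW₀ : finsuppOf W₀ = 0) {i : Fin s} (hW₁ : finsuppOf W₁ = Finsupp.single i 1) :
    h.hsDBasis.repr D W₁ = D (a i) - D 1 * a i := by
  classical
  have hbox : InBox (p ^ e) (Finsupp.single i 1 : Fin s →₀ ℕ) := by rw [← hW₁]; exact inBox_finsuppOf W₁
  have hne : W₁ ≠ W₀ := by
    intro heq
    rw [heq, hW₀] at hW₁
    have := congrArg (fun M : Fin s →₀ ℕ => M i) hW₁
    simp at this
  -- the value of each basis operator on `a_i = a^{e_i}`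
  have hval : ∀ W : Fin s → Fin (p ^ e), h.hsD (finsuppOf W) (a i) =
      (mchoose (Finsupp.single i 1) (finsuppOf W) : K) *
        ∏ j, a j ^ ((Finsupp.single i 1 : Fin s →₀ ℕ) j - finsuppOf W j) := by
    intro W
    rw [← prod_pow_single_eq (a := a) i, h.hsD_prod_pow' _ _ hbox]
  have heval := congrArg (fun Φ : K →ₗ[L] K => Φ (a i)) (h.eq_sum_repr_hsD D)
  simp only [LinearMap.coe_sum, Finset.sum_apply, LinearMap.smul_apply, smul_eq_mul] at heval
  rw [Finset.sum_eq_add W₁ W₀ hne ?_ (fun hc => absurd (Finset.mem_univ _) hc)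
    (fun hc => absurd (Finset.mem_univ _) hc)] at heval
  · rw [hval W₁, hval W₀, hW₁, hW₀, mchoose_self, mchoose_zero_right, Nat.cast_one, one_mul, one_mul] at heval
    have h1 : (∏ j, a j ^ ((Finsupp.single i 1 : Fin s →₀ ℕ) j - (Finsupp.single i 1 : Fin s →₀ ℕ) j)) = (1 : K) :=
      Finset.prod_eq_one fun j _ => by rw [Nat.sub_self, pow_zero]
    have h2 : (∏ j, a j ^ ((Finsupp.single i 1 : Fin s →₀ ℕ) j - (0 : Fin s →₀ ℕ) j)) = a i := by
      have : (∏ j, a j ^ ((Finsupp.single i 1 : Fin s →₀ ℕ) j - (0 : Fin s →₀ ℕ) j)) =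
          ∏ j, a j ^ (Finsupp.single i 1 : Fin s →₀ ℕ) j :=
        Finset.prod_congr rfl fun j _ => by rw [Finsupp.coe_zero, Pi.zero_apply, Nat.sub_zero]
      rw [this, prod_pow_single_eq]
    rw [h1, h2, mul_one, h.hsDBasis_repr_of_eq_zero D hW₀] at heval
    rw [heval]
    ring
  · rintro W - ⟨hW1, hW0⟩
    rw [hval W, mchoose_eq_zero_of_not_le, Nat.cast_zero, zero_mul, mul_zero]
    -- `finsuppOf W ≤ e_i` would force `W = W₀` or `W = W₁`
    intro hle
    rcases Nat.eq_zero_or_pos (finsuppOf W i) with hi0 | hipos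
    · apply hW0
      funext j
      apply Fin.ext
      have hj := hle j
      have h0j := congrArg (fun M : Fin s →₀ ℕ => M j) hW₀
      simp only [finsuppOf_apply, Finsupp.coe_zero, Pi.zero_apply] at hj h0j hi0 ⊢
      rw [h0j]
      by_cases hji : j = i
      · subst hji; exact hi0
      · rw [Finsupp.single_eq_of_ne hji] at hj; omega
    · apply hW1
      funext j
      apply Fin.ext
      have hj := hle j
      have h1j := congrArg (fun M : Fin s →₀ ℕ => M j) hW₁
      simp only [finsuppOf_apply] at hj h1j hipos ⊢
      rw [h1j]
      by_cases hji : j = i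
      · subst hji; rw [Finsupp.single_eq_same] at hj ⊢; omega
      · rw [Finsupp.single_eq_of_ne hji] at hj ⊢; omega

/-- **Mizutani's normal form «`D = a D_1D_2 + b D_1^2 + c D_2^2`»**: an operator of order `≤ 2` with `D 1 = 0` and
`D a_i = 0` for every generator is a `K`-combination of the `D^{(W)}` with `|W| = 2` (for `s = 2`, `p ≠ 2`:
`W ∈ {(2,0), (1,1), (0,2)}`). [cite: Mizutani1973HironakaGroupSchemes, Lemma 2.9 (proof, p. 93)] -/
theorem IsRootTower.eq_sum_degree_two_of_isDiffOpLE_two (h : IsRootTower L K (p ^ e) x a) {D : K →ₗ[L] K}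
    (hD : IsDiffOpLE L 2 D) (h1 : D 1 = 0) (ha : ∀ i, D (a i) = 0) :
    D = ∑ W ∈ (Finset.univ : Finset (Fin s → Fin (p ^ e))).filter (fun W => (finsuppOf W).degree = 2),
      h.hsDBasis.repr D W • h.hsD (finsuppOf W) := by
  classical
  conv_lhs => rw [h.eq_sum_hsD_of_isDiffOpLE hD]
  -- the terms of degree `0` and `1` have vanishing coefficients
  symm
  apply Finset.sum_subset
  · intro W hW
    exact Finset.mem_filter.mpr ⟨Finset.mem_univ W, (Finset.mem_filter.mp hW).2.le⟩
  · intro W hWle hWne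
    have hlt : (finsuppOf W).degree < 2 :=
      lt_of_le_of_ne (Finset.mem_filter.mp hWle).2 fun heq => hWne (Finset.mem_filter.mpr ⟨Finset.mem_univ W, heq⟩)
    suffices hc : h.hsDBasis.repr D W = 0 by rw [hc, zero_smul]
    rcases Nat.lt_or_ge (finsuppOf W).degree 1 with h0 | h1'
    · -- degree `0`: `W = 0`, coefficient `D 1 = 0`
      have hW0 : finsuppOf W = 0 := (Finsupp.degree_eq_zero_iff _).mp (by omega)
      rw [h.hsDBasis_repr_of_eq_zero D hW0, h1]
    · -- degree `1`: `W = e_i`, coefficient `D a_i − (D 1) a_i = 0`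
      have hdeg : (finsuppOf W).degree = 1 := by omega
      obtain ⟨i, hi⟩ : ∃ i, finsuppOf W = Finsupp.single i 1 := by
        have hne : finsuppOf W ≠ 0 := fun h0 => by rw [h0, map_zero] at hdeg; exact zero_ne_one hdeg
        obtain ⟨i, hi⟩ := Finsupp.ne_iff.mp hne
        refine ⟨i, ?_⟩
        have hi1 : 1 ≤ (finsuppOf W) i := Nat.one_le_iff_ne_zero.mpr (by simpa using hi)
        have hle : Finsupp.single i 1 ≤ finsuppOf W := by
          intro j
          by_cases hji : j = i
          · subst hji; rwa [Finsupp.single_eq_same]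
          · rw [Finsupp.single_eq_of_ne hji]; exact Nat.zero_le _
        by_contra hneq
        have := degree_lt_of_lt hle (Ne.symm hneq)
        rw [Finsupp.degree_single, hdeg] at this
        exact lt_irrefl _ this
      -- the index of `0` exists (the box is non-empty in each coordinate)
      have hq : 0 < p ^ e := pow_pos hp.out.pos e
      have hW₀ : finsuppOf (fun _ : Fin s => (⟨0, hq⟩ : Fin (p ^ e))) = 0 := by
        ext j; simp [finsuppOf_apply]
      rw [h.hsDBasis_repr_of_eq_single D hW₀ hi, ha i, h1, zero_mul, sub_zero]

end NormalForm

end Summit.ResolutionOfSingularities.KangarooAtlas.Mizutani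

end
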